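import Summits.Ventures.CertifiedManyBodySolver.Downfold.EmeryFermiSurfaceShapeBox
import HarnessLib

/-!
# THE WHOLE-BAND (OBJECT-M) HOPPINGS OF A σ SET ARE THE 2-JET OF ITS BAND: the Taylor 2-jet of the implicit
# σ band `ε = E(x, y)` in closed form, its one-band `(t, t′, t″)` reading, and THE EXACT NESTING FOLD OF THE JET
# `t′_J − 2t″_J = −fsN/∂_ε charCubic = fsRatio · scaleT` — object M's `t′ − 2t″` IS object E's `t′` (in eV)

Venture CertifiedManyBodySolver, cell `pub/hubbard-downfold` (stage S1), seat hubbard-downfold-mod-4 (technique B, g44;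
INFL-3to1-B §B.100); namespace `Summit.Ventures.CertifiedManyBodySolver.Downfold.Emery`. Everything PROVED (exact algebra;
the jet property is an EXACT polynomial identity, no analysis).

WHY. The cell's 1BH box of record carries two one-band objects of the same DFT band (box #18 §OF-RECORD l.184): object M
(MLWF / whole-band `t–t′–t″` set: La₂CuO₄ `t′/t ≈ −0.07`, `t″/t ≈ +0.09`) and object E (near-Fermi-surface `t–t′` refit:
`t′/t ≈ −0.25`). `EmeryFermiSurfaceShape` (§B.13) showed every σ constant-energy contour is EXACTLY `t–t′` (object E's
shape `t′/t = fsRatio`, `t″ ≡ 0`) and `EmeryFermiSurfaceHarmonics` (§B.99) that no standard one-body extension except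
`t_pp″`, `t_dd` makes an exact `t″`. So where does object M's `t″ ≈ +0.09·t` come from? From the ENERGY DEPENDENCE of
the contour coefficients: the band `E(x, y)` (`x = sin²(kx/2)`, `y = sin²(ky/2)`), i.e. the implicit root of
`F = charCubic = cA(ε) − 4fsD(ε)(x + y) − 16fsN(ε)xy`, has a Taylor 2-jet with `x²`, `y²` terms although every one of
its level sets is bilinear.

* §1 THE 2-JET IN CLOSED FORM. Partials of `F` (all polynomial): `∂ₓF = −gradX` (`gradX = 4fsD + 16fsN·y`),
  `∂_εF = dcharCubic`, `∂ₓ∂_εF = −dgradX` (`dgradX = 4fsD′ + 16fsN′·y`), `½∂_ε²F = taylor2 = 3ε + 2Δ + 4c(x + y)`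
  (`charCubic_taylor`), `∂ₓ∂_yF = −16fsN`, `∂ₓ∂_y∂_εF = −16fsN′`. Jet coefficients (implicit differentiation, [folklore]):
  `jetP = gradX(y)/∂_εF` (= `E_x`), `jetQ = gradX(x)/∂_εF` (= `E_y`), `jetR = (2·jetP·dgradX(y) − 2·taylor2·jetP²)/∂_εF`
  (= `E_xx`), `jetW` (= `E_yy`), `jetS = (16fsN + jetQ·dgradX(y) + jetP·dgradX(x) − 2·taylor2·jetP·jetQ)/∂_εF` (= `E_xy`).
* §2 THE EXACT SECOND-ORDER IDENTITY (pure `ring`): `charCubic_shift_expand` — `F(x + u, y + v, ε + h) = F − u·gradX(y)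
  − v·gradX(x) − 16fsN·uv + h(∂_εF − u·dgradX(y) − v·dgradX(x) − 16fsN′uv) + h²(taylor2 + 4c(u + v)) + h³` for all
  `u v h`; `charCubic_jet_expand` — along a quadratic energy surface `h = L + Q` (`L` linear, `Q` quadratic in `(u, v)`)
  the expansion groups into the degree-1 part `L∂_εF − u·gradX(y) − v·gradX(x)`, the degree-2 part `Q∂_εF − L(u·dgradX(y)
  + v·dgradX(x)) + L²taylor2 − 16fsN·uv` and a remainder `jetRem` of degree ≥ 3; `jet_order1` / `jet_order2`: the
  closed-form jet KILLS both groups (`∂_εF ≠ 0`); hence `charCubic_jet_residual`: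
  `F(x + u, y + v, ε + jet(u, v)) = F(x, y, ε) + jetRem(u, v)` — at a band point (`F = 0`) the closed forms ARE the
  Taylor coefficients of the band to second order (the defining property of the 2-jet of the implicit function;
  uniqueness is the invertibility of `∂_εF`).
* §3 THE ONE-BAND READING AT A DIAGONAL POINT `x = y = x₀` (node direction): the jet `E + p(u + v) + ½r(u² + v²) + suv` is
  the symmetric quadratic with `t″_J = −r/32`, `t′_J = −s/16`, `t_J = (p + (s + r)(½ − x₀))/4` (`oneBandXY_eq_symQuad`
  dictionary; `jetTpp`, `jetTp`, `jetT`). THEOREMS: (i) `jetTpp_eq` — **`t″_J = jetP·(jetP·taylor2 − dgradX)/(16∂_εF)`**: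
  object M's `t″` is PURE ENERGY DEPENDENCE (only ε-derivatives `fsD′`, `fsN′`, `taylor2` of the secular weights enter;
  `jetTpp_pos_iff`: `t″_J > 0` iff the band velocity times the ε-curvature beats the ε-slope of the contour weights,
  `jetP·taylor2 > dgradX`); (ii) **THE EXACT NESTING FOLD OF THE JET** `jetTp_sub_two_jetTpp`:
  **`t′_J − 2t″_J = −fsN/∂_εF`**, and `= fsRatio · scaleT` (`jetTp_sub_two_jetTpp_eq_fsRatio_mul_scaleT`) — the
  whole-band `t′ − 2t″` of a σ set at a diagonal point IS the exact Fermi-surface shape ratio times the velocity-matched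
  nodal scale: OBJECT M's `t′ − 2t″` = OBJECT E's `t′` in eV, at every energy, with NO remainder (the `o(r)` of
  [PavariniEtAl2001]'s `t″ ≈ t′/2` and the «to first order» of `OneBandNestingFold` are exact here); (iii) `jetT_half`: on
  the nesting line `x₀ = ½` moreover `t_J = scaleT`, so `(t′_J − 2t″_J)/t_J = fsRatio` exactly; (iv) the general-point fold
  `jet_fold_general`: `E_xy − (E_y/2E_x)E_xx − (E_x/2E_y)E_yy = 16fsN/∂_εF` at any band point.

WHAT THIS IS NOT: statements about materials (the La₂CuO₄ readings — jet at the node of the c row: `t′/t −0.073`,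
`t″/t +0.101` vs MLWF object M `−0.071 / +0.090` — live in INFLATION-RULES-3to1-B §B.100, float); not a Wannier
construction (object M of a DFT band is a global Fourier object; that it agrees with the nodal jet to ≤ 0.01 is an
observation of §B.100, not a theorem); `U = 0` one-body kinematics. Sources: [AndersenEtAl1995, §6];
[PavariniEtAl2001, Eq. (1) and the remark `t″ ≈ t′/2`]; [HybertsenSchluterChristensen1989, Eq. (1)].
-/

noncomputable section

namespace Summit.Ventures.CertifiedManyBodySolver.Downfold.Emery

open Real

/-! ## §1 Partials of the secular cubic and the closed-form 2-jet -/

/-- Minus the `x`-derivative of the secular cubic at fixed energy: `gradX = 4fsD + 16fsN·y`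
(`hasDerivAt_charCubic_x`: `∂ₓ charCubic = −gradX`). [folklore] -/
def gradX (Δ tpd tpp c y ε : ℝ) : ℝ := 4 * fsD Δ tpd c ε + 16 * fsN tpd tpp c ε * y

/-- Minus the mixed derivative `∂ₓ∂_ε charCubic`: `dgradX = 4fsD′ + 16fsN′·y`. [folklore] -/
def dgradX (Δ tpd tpp c y ε : ℝ) : ℝ := 4 * dfsD Δ tpd c ε + 16 * dfsN tpp c * y

/-- Half the second energy derivative of the secular cubic: `taylor2 = 3ε + 2Δ + 4c(x + y)` (the `h²` coefficient
of `charCubic_taylor`). [folklore] -/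
def taylor2 (Δ c x y ε : ℝ) : ℝ := 3 * ε + 2 * Δ + 4 * c * (x + y)

/-- The jet slope `E_x = −∂ₓF/∂_εF = gradX(y)/dcharCubic`. [folklore] -/
def jetP (Δ tpd tpp c x y ε : ℝ) : ℝ := gradX Δ tpd tpp c y ε / dcharCubic Δ tpd tpp c x y ε

/-- The jet slope `E_y = gradX(x)/dcharCubic`. [folklore] -/
def jetQ (Δ tpd tpp c x y ε : ℝ) : ℝ := gradX Δ tpd tpp c x ε / dcharCubic Δ tpd tpp c x y ε

/-- The jet curvature `E_xx = (2E_x·dgradX(y) − 2·taylor2·E_x²)/∂_εF` (from `∂ₓ²F = 0`). [folklore] -/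
def jetR (Δ tpd tpp c x y ε : ℝ) : ℝ :=
  (2 * jetP Δ tpd tpp c x y ε * dgradX Δ tpd tpp c y ε - 2 * taylor2 Δ c x y ε * jetP Δ tpd tpp c x y ε ^ 2)
    / dcharCubic Δ tpd tpp c x y ε

/-- The jet curvature `E_yy`. [folklore] -/
def jetW (Δ tpd tpp c x y ε : ℝ) : ℝ :=
  (2 * jetQ Δ tpd tpp c x y ε * dgradX Δ tpd tpp c x ε - 2 * taylor2 Δ c x y ε * jetQ Δ tpd tpp c x y ε ^ 2)
    / dcharCubic Δ tpd tpp c x y ε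

/-- The mixed jet coefficient `E_xy = (16fsN + E_y·dgradX(y) + E_x·dgradX(x) − 2·taylor2·E_xE_y)/∂_εF`. [folklore] -/
def jetS (Δ tpd tpp c x y ε : ℝ) : ℝ :=
  (16 * fsN tpd tpp c ε + jetQ Δ tpd tpp c x y ε * dgradX Δ tpd tpp c y ε
      + jetP Δ tpd tpp c x y ε * dgradX Δ tpd tpp c x ε
      - 2 * taylor2 Δ c x y ε * jetP Δ tpd tpp c x y ε * jetQ Δ tpd tpp c x y ε)
    / dcharCubic Δ tpd tpp c x y ε

/-- The remainder of the second-order expansion along a quadratic energy surface `h = L + Q` (`L` the linear, `Q`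
the quadratic part in `(u, v)`): every term has total degree ≥ 3 in `(u, v)` once `L` is linear and `Q` quadratic.
[folklore] -/
def jetRem (Δ tpd tpp c x y ε L Q u v : ℝ) : ℝ :=
  -(Q * (u * dgradX Δ tpd tpp c y ε + v * dgradX Δ tpd tpp c x ε))
  - 16 * dfsN tpp c * (u * v) * (L + Q)
  + (2 * L * Q + Q ^ 2) * taylor2 Δ c x y ε
  + 4 * c * (u + v) * (L + Q) ^ 2 + (L + Q) ^ 3

/-! ## §2 The exact second-order identity -/

/-- THE EXACT SHIFT IDENTITY of the secular cubic (bilinear in `(x, y)`, cubic in `ε`): for all `u v h`,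
`F(x + u, y + v, ε + h) = F − u·gradX(y) − v·gradX(x) − 16fsN·uv + h·(∂_εF − u·dgradX(y) − v·dgradX(x) − 16fsN′·uv)
+ h²·(taylor2 + 4c(u + v)) + h³` (`charCubic_bilinear` ∘ `charCubic_taylor`). [folklore] -/
theorem charCubic_shift_expand (Δ tpd tpp c x y ε u v h : ℝ) :
    charCubic Δ tpd tpp c (x + u) (y + v) (ε + h) =
      charCubic Δ tpd tpp c x y ε - u * gradX Δ tpd tpp c y ε - v * gradX Δ tpd tpp c x ε
        - 16 * fsN tpd tpp c ε * (u * v)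
      + h * (dcharCubic Δ tpd tpp c x y ε - u * dgradX Δ tpd tpp c y ε - v * dgradX Δ tpd tpp c x ε
          - 16 * dfsN tpp c * (u * v))
      + h ^ 2 * (taylor2 Δ c x y ε + 4 * c * (u + v)) + h ^ 3 := by
  unfold charCubic gradX dgradX taylor2 dcharCubic fsD fsN dcA dfsD dfsN
  ring

/-- THE EXACT SECOND-ORDER EXPANSION along a quadratic energy surface `h = L + Q` over `(x + u, y + v)` (for ALL real
`L`, `Q`; read with `L = pu + qv` linear and `Q = ½ru² + suv + ½wv²` quadratic): degree-1 group `L·∂_εF − u·gradX(y)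
− v·gradX(x)`, degree-2 group `Q·∂_εF − L·(u·dgradX(y) + v·dgradX(x)) + L²·taylor2 − 16fsN·uv`, and the degree-≥-3
remainder `jetRem`. [folklore] -/
theorem charCubic_jet_expand (Δ tpd tpp c x y ε u v L Q : ℝ) :
    charCubic Δ tpd tpp c (x + u) (y + v) (ε + (L + Q)) =
      charCubic Δ tpd tpp c x y ε
      + (L * dcharCubic Δ tpd tpp c x y ε - u * gradX Δ tpd tpp c y ε - v * gradX Δ tpd tpp c x ε)
      + (Q * dcharCubic Δ tpd tpp c x y ε - L * (u * dgradX Δ tpd tpp c y ε + v * dgradX Δ tpd tpp c x ε)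
          + L ^ 2 * taylor2 Δ c x y ε - 16 * fsN tpd tpp c ε * (u * v))
      + jetRem Δ tpd tpp c x y ε L Q u v := by
  rw [charCubic_shift_expand]
  unfold jetRem
  ring

/-- The closed-form jet KILLS the degree-1 group: with `L = jetP·u + jetQ·v`,
`L·∂_εF − u·gradX(y) − v·gradX(x) = 0` (`∂_εF ≠ 0`). [folklore] -/
theorem jet_order1 {Δ tpd tpp c x y ε : ℝ} (hF : dcharCubic Δ tpd tpp c x y ε ≠ 0) (u v : ℝ) :
    (jetP Δ tpd tpp c x y ε * u + jetQ Δ tpd tpp c x y ε * v) * dcharCubic Δ tpd tpp c x y ε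
      - u * gradX Δ tpd tpp c y ε - v * gradX Δ tpd tpp c x ε = 0 := by
  unfold jetP jetQ; field_simp; ring

/-- The closed-form jet KILLS the degree-2 group: with `L = jetP·u + jetQ·v`, `Q = ½jetR·u² + jetS·uv + ½jetW·v²`,
`Q·∂_εF − L·(u·dgradX(y) + v·dgradX(x)) + L²·taylor2 − 16fsN·uv = 0` (`∂_εF ≠ 0`). [folklore] -/
theorem jet_order2 {Δ tpd tpp c x y ε : ℝ} (hF : dcharCubic Δ tpd tpp c x y ε ≠ 0) (u v : ℝ) :
    (jetR Δ tpd tpp c x y ε * u ^ 2 / 2 + jetS Δ tpd tpp c x y ε * u * v + jetW Δ tpd tpp c x y ε * v ^ 2 / 2)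
        * dcharCubic Δ tpd tpp c x y ε
      - (jetP Δ tpd tpp c x y ε * u + jetQ Δ tpd tpp c x y ε * v)
        * (u * dgradX Δ tpd tpp c y ε + v * dgradX Δ tpd tpp c x ε)
      + (jetP Δ tpd tpp c x y ε * u + jetQ Δ tpd tpp c x y ε * v) ^ 2 * taylor2 Δ c x y ε
      - 16 * fsN tpd tpp c ε * (u * v) = 0 := by
  unfold jetR jetS jetW; field_simp; ring

/-- THE 2-JET PROPERTY (exact): with the closed-form coefficients the secular cubic along the jet surface equals its
value at the base point plus the degree-≥-3 remainder, `F(x + u, y + v, ε + jet(u, v)) = F(x, y, ε) + jetRem` for all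
`u, v` (`∂_εF ≠ 0`). At a band point (`F(x, y, ε) = 0`) this says the band's graph and the jet surface have contact
of order 2: `(jetP, jetQ, jetR, jetS, jetW)` are the first and second Taylor coefficients of the implicit band
`E(x, y)` (uniqueness = invertibility of `∂_εF`). [folklore] -/
theorem charCubic_jet_residual {Δ tpd tpp c x y ε : ℝ} (hF : dcharCubic Δ tpd tpp c x y ε ≠ 0) (u v : ℝ) :
    charCubic Δ tpd tpp c (x + u) (y + v)
        (ε + ((jetP Δ tpd tpp c x y ε * u + jetQ Δ tpd tpp c x y ε * v)
          + (jetR Δ tpd tpp c x y ε * u ^ 2 / 2 + jetS Δ tpd tpp c x y ε * u * v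
              + jetW Δ tpd tpp c x y ε * v ^ 2 / 2))) =
      charCubic Δ tpd tpp c x y ε
      + jetRem Δ tpd tpp c x y ε (jetP Δ tpd tpp c x y ε * u + jetQ Δ tpd tpp c x y ε * v)
          (jetR Δ tpd tpp c x y ε * u ^ 2 / 2 + jetS Δ tpd tpp c x y ε * u * v + jetW Δ tpd tpp c x y ε * v ^ 2 / 2)
          u v := by
  rw [charCubic_jet_expand, jet_order1 hF u v, jet_order2 hF u v]
  ring

/-! ## §3 The one-band reading of the jet at a diagonal point and the exact nesting fold -/

/-- The jet's one-band `t″` at a diagonal point `x = y = x₀`: `t″_J = −E_xx/32` (the `x² + y²` coefficient `½E_xx`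
read through `oneBandXY_eq_symQuad`: `a₃ = −16t″`). [folklore] -/
def jetTpp (Δ tpd tpp c x₀ ε : ℝ) : ℝ := -jetR Δ tpd tpp c x₀ x₀ ε / 32

/-- The jet's one-band `t′` at a diagonal point: `t′_J = −E_xy/16` (`a₂ = −16t′`). [folklore] -/
def jetTp (Δ tpd tpp c x₀ ε : ℝ) : ℝ := -jetS Δ tpd tpp c x₀ x₀ ε / 16

/-- The jet's one-band `t` at a diagonal point: re-centring the quadratic `E + p(u + v) + ½r(u² + v²) + suv` to the
absolute variables gives `a₁ = p − (s + r)x₀`, and `t = (a₁ + a₂/2 + a₃)/4 = (p + (s + r)(½ − x₀))/4`. [folklore] -/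
def jetT (Δ tpd tpp c x₀ ε : ℝ) : ℝ :=
  (jetP Δ tpd tpp c x₀ x₀ ε + (jetS Δ tpd tpp c x₀ x₀ ε + jetR Δ tpd tpp c x₀ x₀ ε) * (1 / 2 - x₀)) / 4

/-- At a diagonal point the two slopes agree: `jetQ = jetP`. [folklore] -/
theorem jetQ_diag (Δ tpd tpp c x₀ ε : ℝ) : jetQ Δ tpd tpp c x₀ x₀ ε = jetP Δ tpd tpp c x₀ x₀ ε := rfl

/-- **`t″` OF THE JET IS PURE ENERGY DEPENDENCE**: `t″_J = jetP·(jetP·taylor2 − dgradX)/(16·∂_εF)` — only the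
ε-derivatives `fsD′`, `fsN′` (in `dgradX`) and the ε-curvature `taylor2` of the secular weights enter; a band whose
contour weights did not move with the energy would have `t″_J = 0`. [folklore] -/
theorem jetTpp_eq (Δ tpd tpp c x₀ ε : ℝ) :
    jetTpp Δ tpd tpp c x₀ ε =
      jetP Δ tpd tpp c x₀ x₀ ε * (jetP Δ tpd tpp c x₀ x₀ ε * taylor2 Δ c x₀ x₀ ε - dgradX Δ tpd tpp c x₀ ε)
        / (16 * dcharCubic Δ tpd tpp c x₀ x₀ ε) := by
  unfold jetTpp jetR
  ring

/-- SIGN OF THE JET `t″` (positive `∂_εF`, positive velocity `jetP`): `t″_J > 0` iff `jetP·taylor2 > dgradX` —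
the band velocity times the energy curvature of the secular cubic beats the energy slope of the contour weights.
[folklore] -/
theorem jetTpp_pos_iff {Δ tpd tpp c x₀ ε : ℝ} (hF : 0 < dcharCubic Δ tpd tpp c x₀ x₀ ε)
    (hP : 0 < jetP Δ tpd tpp c x₀ x₀ ε) :
    0 < jetTpp Δ tpd tpp c x₀ ε ↔ dgradX Δ tpd tpp c x₀ ε < jetP Δ tpd tpp c x₀ x₀ ε * taylor2 Δ c x₀ x₀ ε := by
  rw [jetTpp_eq]
  have h16 : 0 < 16 * dcharCubic Δ tpd tpp c x₀ x₀ ε := by positivity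
  rw [div_pos_iff_of_pos_right h16, mul_pos_iff_of_pos_left hP, sub_pos]

/-- **THE EXACT NESTING FOLD OF THE JET**: at every diagonal point and every energy,
`t′_J − 2t″_J = −fsN/∂_εF` (`∂_εF ≠ 0`). [folklore] -/
theorem jetTp_sub_two_jetTpp {Δ tpd tpp c x₀ ε : ℝ} (hF : dcharCubic Δ tpd tpp c x₀ x₀ ε ≠ 0) :
    jetTp Δ tpd tpp c x₀ ε - 2 * jetTpp Δ tpd tpp c x₀ ε = -fsN tpd tpp c ε / dcharCubic Δ tpd tpp c x₀ x₀ ε := by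
  unfold jetTp jetTpp jetS jetR jetQ jetP
  field_simp
  ring

/-- … equivalently **`t′_J − 2t″_J = fsRatio · scaleT`**: the whole-band `t′ − 2t″` of the jet IS the exact
Fermi-surface shape ratio (`EmeryFermiSurfaceShape.fsRatio`, object E's `t′/t`) times the velocity-matched nodal scale
(`EmeryFermiSurfaceShapeBox.scaleT`, object E's `t` in eV) — OBJECT M's `t′ − 2t″` = OBJECT E's `t′`, exactly
(`∂_εF ≠ 0`, `fsT ≠ 0`). [cite: PavariniEtAl2001, Eq. (1) (remark `t″ ≈ t′/2`, here an identity)] -/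
theorem jetTp_sub_two_jetTpp_eq_fsRatio_mul_scaleT {Δ tpd tpp c x₀ ε : ℝ}
    (hF : dcharCubic Δ tpd tpp c x₀ x₀ ε ≠ 0) (hT : fsT Δ tpd tpp c ε ≠ 0) :
    jetTp Δ tpd tpp c x₀ ε - 2 * jetTpp Δ tpd tpp c x₀ ε =
      fsRatio Δ tpd tpp c ε * scaleT Δ tpd tpp c x₀ x₀ ε := by
  have hT' : fsD Δ tpd c ε + 2 * fsN tpd tpp c ε ≠ 0 := by unfold fsT at hT; exact hT
  have key : fsRatio Δ tpd tpp c ε * scaleT Δ tpd tpp c x₀ x₀ ε =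
      -fsN tpd tpp c ε / dcharCubic Δ tpd tpp c x₀ x₀ ε := by
    unfold fsRatio scaleT fsT
    rw [div_mul_div_comm, mul_comm (-fsN tpd tpp c ε), mul_div_mul_left _ _ hT']
  rw [key]
  exact jetTp_sub_two_jetTpp hF

/-- ON THE NESTING LINE `x₀ = ½` the jet's `t` IS the velocity-matched scale: `t_J = scaleT` (`∂_εF ≠ 0`).
[folklore] -/
theorem jetT_half {Δ tpd tpp c ε : ℝ} (hF : dcharCubic Δ tpd tpp c (1 / 2) (1 / 2) ε ≠ 0) :
    jetT Δ tpd tpp c (1 / 2) ε = scaleT Δ tpd tpp c (1 / 2) (1 / 2) ε := by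
  unfold jetT jetP gradX scaleT fsT
  field_simp
  ring

/-- … hence on the nesting line the fold holds in RATIO form: `(t′_J − 2t″_J)/t_J = fsRatio` (`∂_εF ≠ 0`,
`fsT ≠ 0`). [folklore] -/
theorem jet_fold_ratio_half {Δ tpd tpp c ε : ℝ} (hF : dcharCubic Δ tpd tpp c (1 / 2) (1 / 2) ε ≠ 0)
    (hT : fsT Δ tpd tpp c ε ≠ 0) :
    (jetTp Δ tpd tpp c (1 / 2) ε - 2 * jetTpp Δ tpd tpp c (1 / 2) ε) / jetT Δ tpd tpp c (1 / 2) ε =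
      fsRatio Δ tpd tpp c ε := by
  rw [jetTp_sub_two_jetTpp_eq_fsRatio_mul_scaleT hF hT, jetT_half hF]
  have hS : scaleT Δ tpd tpp c (1 / 2) (1 / 2) ε ≠ 0 := by
    unfold scaleT; exact div_ne_zero hT hF
  field_simp

/-- THE GENERAL-POINT FOLD: at ANY point with `∂_εF ≠ 0` and non-zero slopes,
`E_xy − (E_y/(2E_x))·E_xx − (E_x/(2E_y))·E_yy = 16fsN/∂_εF` — the mixed second derivative minus the
slope-weighted pure ones is the contour's `xy` weight over the velocity denominator (the jet's `t′`-like combination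
that is free of energy dependence). [folklore] -/
theorem jet_fold_general {Δ tpd tpp c x y ε : ℝ} (hF : dcharCubic Δ tpd tpp c x y ε ≠ 0)
    (hP : jetP Δ tpd tpp c x y ε ≠ 0) (hQ : jetQ Δ tpd tpp c x y ε ≠ 0) :
    jetS Δ tpd tpp c x y ε - jetQ Δ tpd tpp c x y ε / (2 * jetP Δ tpd tpp c x y ε) * jetR Δ tpd tpp c x y ε
        - jetP Δ tpd tpp c x y ε / (2 * jetQ Δ tpd tpp c x y ε) * jetW Δ tpd tpp c x y ε =
      16 * fsN tpd tpp c ε / dcharCubic Δ tpd tpp c x y ε := by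
  unfold jetS jetR jetW
  field_simp
  ring

end Summit.Ventures.CertifiedManyBodySolver.Downfold.Emery
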